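import Summits.QuantumFields.YangMills.Theorems.UnitScaleTiltProp7LatticeLocalisedMass
import Summits.QuantumFields.YangMills.Theorems.UnitScaleTiltProp7TentInterpolation
import Literature.MathematicalPhysics.QuantumFieldTheory.Balaban1983to89.B10Eq27TorusAxialLog
import HarnessLib

/-!
# Route `UnitScaleTilt`, crux K1 «MinimiserStabilityRegPr» (stmt-QuantumFields-19200), route-R E′ (A′)-on-Σ, P-A2 (β), row «(n3)₂-sym» = H2-1ˢ —
# N-line file N4: THE LEVEL-0 LOCALISED MASS ON T³ BLOCK FIBRES (px18's ℤ³ Hardy-type row ✓`Prop7LatticeLocalisedMass.sum_sq_le_localisedMass`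
# transported to the torus `Site P 0` and summed over the level-`l` block fibres)

Cell `ym3-torus` (YM ladder rung R3 — continuum SU(2) YM₃ on T³ — a RUNG, NOT d = 4, NOT infinite volume, NOT a mass gap, NOT the Clay problem).
Width seat `ym-ust-20520-w3` gen 11 on the N-line namer px21 g7's word «N4 → w3-20520 g11» (2026-08-29T08:02:49Z; LOCATE «H2-1ˢ» 3c6e40d5 §4).
THEOREMS ONLY (0 `def`, 0 `sorry`); `--kind proof --supports stmt-QuantumFields-19200 --as helper`; count-neutral.  Nothing here proves `hN2s`, H2-1ˢ, (β),
`hD`, the stub `stub_existenceMinimalOrbit`, the crux or any summit statement.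

## The point (LOCATE «H2-1ˢ» §4)
The sparse `Λ`-channel of the sourced true-linearisation tower (px21 N1 `…TrueLinSourcedSparseL1`) reads the first-order ratio field only NEAR THE CENTRES of the
level-`l` blocks; its level-0 cost is therefore `Σ_{y ∈ T^{(l)}} (mass of the field in the sup-ball of radius ρ around the centre embIter l y)`.  px18 g4's ✓ A-1
`Prop7LatticeLocalisedMass.sum_sq_le_localisedMass` bounds, ON `ℤ³`, the mass in a small box `Q_ρ(a)` by the VOLUME FRACTION `#Q_ρ∕#Q_R` of the mass in a big
concentric box `Q_R(a)` plus `13068·(ρ+1)²` times the gradient energy on `Q_R(a)` (`d = 3`, Hardy-type, no `R`, no log).  THIS FILE transports that row to the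
torus `Site P j` through the lit dictionary `transl c z = c + z` ∕ `rel c x = (x − c)` read in least-absolute-value representatives ([`B10Eq27TorusAxialLog`]) — the
box `Q_r(0) ⊂ ℤ^d` maps BIJECTIVELY onto the sup-ball `{x : ∀ κ, |(x κ − c κ).valMinAbs| ≤ r}` as long as `2r + 1 ≤` the period (no wrap) — and sums it over any
family of centres with pairwise DISJOINT big balls; at `j = 0`, centres `embIter l y` (`y ∈ T^{(l)}`) and `R = (L^l − 1)∕2` the big balls are exactly the level-`l`
block fibres `B^l(y)` (lit ✓`B5Eq118OneStroke.iterBlock`, pairwise disjoint), so the two right-hand sums are GLOBAL torus sums.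

## What is proved (ns `…Theorems.Prop7LatticeLocalisedMassT3`; every set written INLINE as a `Finset.filter`, no definition)
* §1 (any `P`, any level `j`, window `2r + 1 ≤ sitesPerDir j`): `window_of_mem_box`, `rel_transl_of_mem_box`, `transl_mem_ball`,
  `rel_mem_box`, ★ `image_transl_box` (`Q_r(0) ↦ ball_r(c)` onto), `injOn_transl_box`, ★ `sum_ball_eq_sum_box` (`Σ_{ball_r(c)} f = Σ_{Q_r(0)} f ∘ transl c`).
* §2 (`P.d = 3`) ★★ `sum_sq_ball_le_localisedMass` — px18's row ON THE TORUS for one centre `c` and radii `ρ ≤ R`, `2R + 1 ≤ sitesPerDir j`: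
  `Σ_{ball_ρ(c)} v² ≤ (1+t)·((2ρ+1)³∕(2R+1)³)·Σ_{ball_R(c)} v² + (1+t⁻¹)·13068·(ρ+1)²·Σ_{x ∈ ball_R(c)} Σ_μ (v(x.shift μ) − v x)²`.
* §3 (`P.d = 3`) ★★ `sum_sum_sq_ball_le_of_disjoint` — the same summed over a finite family of centres `c i` whose `R`-balls are pairwise disjoint: right-hand sides
  become the GLOBAL sums `Σ_x v x²`, `Σ_x Σ_μ (v(x.shift μ) − v x)²`.
* §4 (level-`l` block fibres of `Site P 0`, `l ≤ m + K`): `pow_le_sitesPerDir_zero`, ★ `ball_embIter_eq_iterBlock`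
  (the `(L^l−1)∕2`-ball around `embIter l y` IS `B^l(y)`), `disjoint_ball_embIter`, and ★★★ **`sum_sq_le_localisedMass_T3`** — THE N4 ROW (px21's cut VERBATIM):
  for `hd : P.d = 3`, `l ≤ m + K`, `v : Site P 0 → ℝ`, `2ρ + 1 ≤ L^l`, `t > 0`,
  `Σ_{y : Site P l} Σ_{x : ∀ κ, |(x κ − (embIter l y) κ).valMinAbs| ≤ ρ} (v x)² ≤ (1+t)·((2ρ+1)³∕(L^l)³)·Σ_x (v x)² + (1+t⁻¹)·13068·(ρ+1)²·Σ_x Σ_ν (v (x.shift ν) − v x)²`.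
* §5 the `‖·‖²` twins for a field with values in any seminormed group `V` (NO inner product asked — usable at `Matrix (Fin 2) (Fin 2) ℂ` with the `L²`-operator norm):
  `sq_norm_sub_norm_le` (`(‖a‖ − ‖b‖)² ≤ ‖a − b‖²`), ★★ `sum_normSq_le_localisedMass_T3` (site fields `Y : Site P 0 → V`, gradient term `Σ_x Σ_ν ‖Y(x.shift ν) − Y x‖²`),
  ★★ `sum_normSq_bond_le_localisedMass_normGap_T3` (bond fields `Y : PBond P 0 → V`, balls read on `b.src`, gradient term in the NORM-GAP currency
  `Σ_b Σ_ν (‖Y ⟨b.src.shift ν, b.dir⟩‖ − ‖Y b‖)²` — an EXACT per-direction rearrangement, the letter px13 g6's N4b bounds by the covariant gradient) and its plain-difference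
  corollary ★★ `sum_normSq_bond_le_localisedMass_T3` (`Σ_b Σ_ν ‖Y ⟨b.src.shift ν, b.dir⟩ − Y b‖²`).
DEPENDENCE: the constant `13068` is px18's ABSOLUTE one; NOTHING depends on `l`, `K`, `n`, the member, `ε₀`; `L` enters only through `(L^l)³` = the fibre volume.
HONEST: bookkeeping (a bijection, a disjoint union, a reverse triangle inequality) over px18's analysis; nothing of H2-1ˢ's knit ∕ `hN2s` ∕ `hMcomb₂` ∕ (β) ∕ the crux is
proved or claimed; rung R3 (YM₃ on T³), NOT d = 4, NOT infinite volume, NOT Clay; YM gap NOT proved.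
References: M. Giaquinta, *Multiple integrals in the calculus of variations and nonlinear elliptic systems*, Princeton 1983 [Giaquinta1984] (Ch. III §1 pp.64–72);
T. Bałaban, CMP 96 (1984) 223–250 [Balaban1984PropagatorsII] ((1.9) p.226); CMP 95 (1984) 17–40 [Balaban1984PropagatorsI] ((1.6), (1.18) pp.18–20: blocks `B^k(y)`);
CMP 109 (1987) 249–301 [Balaban1987RG1] ((0.1) p.251: the torus lattices and the centre embedding).
-/

set_option autoImplicit false

noncomputable section

open scoped BigOperators

namespace Summit.QuantumFields.YangMills.Theorems.Prop7LatticeLocalisedMassT3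

open Literature.MathematicalPhysics.QuantumFieldTheory.Balaban1983to89
open B4Eq19LatticeOperators (Zd box mem_box card_box unitVec gradSq gradSq_def fdiff fdiff_apply)
open B10Eq27TorusAxialLog (transl rel transl_apply rel_apply transl_rel rel_transl_of_mem transl_add_e)
open B15DeterminingSets (embIter)
open B5Eq118OneStroke (iterBlock mem_iterBlock_iff pairwiseDisjoint_iterBlock)
open Summit.QuantumFields.YangMills.Theorems.Prop7LatticeLocalisedMass (sum_sq_le_localisedMass)
open Summit.QuantumFields.YangMills.Theorems.Prop7TentInterpolation (val_embIter)
open Finset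

variable {P : Params} {j : ℕ}

/-! ## §1 The no-wrap window dictionary `Q_r(0) ⊂ ℤ^d ↔ ball_r(c) ⊂ T^{(j)}` (any `P`, any level `j`) -/

/-- the window: a point of `Q_r(0)` has every coordinate in print's symmetric range `2z_ν ∈ (−N, N]` once `2r + 1 ≤ N`. [folklore] [cite: Balaban1987RG1, (0.1) p.251] -/
theorem window_of_mem_box {r : ℕ} (hr : 2 * r + 1 ≤ P.sitesPerDir j) {z : Zd P.d} (hz : z ∈ box (0 : Zd P.d) (r : ℤ)) (ν : Fin P.d) :
    z ν * 2 ∈ Set.Ioc (-(P.sitesPerDir j : ℤ)) (P.sitesPerDir j) := by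
  have h := (mem_box.mp hz) ν
  rw [Pi.zero_apply, sub_zero] at h
  obtain ⟨h1, h2⟩ := abs_le.mp h
  have hr' : (2 * r + 1 : ℤ) ≤ (P.sitesPerDir j : ℤ) := by exact_mod_cast hr
  constructor <;> linarith

/-- `(c + z) − c = z` for `z ∈ Q_r(0)` in the window (lit ✓`rel_transl_of_mem`). [folklore] [cite: Balaban1987RG1, (0.1) p.251] -/
theorem rel_transl_of_mem_box (c : Site P j) {r : ℕ} (hr : 2 * r + 1 ≤ P.sitesPerDir j) {z : Zd P.d}
    (hz : z ∈ box (0 : Zd P.d) (r : ℤ)) : rel c (transl c z) = z :=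
  rel_transl_of_mem c z (window_of_mem_box hr hz)

/-- `c + Q_r(0) ⊆ ball_r(c)`. [folklore] [cite: Balaban1987RG1, (0.1) p.251] -/
theorem transl_mem_ball (c : Site P j) {r : ℕ} (hr : 2 * r + 1 ≤ P.sitesPerDir j) {z : Zd P.d} (hz : z ∈ box (0 : Zd P.d) (r : ℤ)) :
    transl c z ∈ univ.filter (fun x : Site P j => ∀ κ, ((x κ - c κ).valMinAbs).natAbs ≤ r) := by
  rw [mem_filter]
  refine ⟨mem_univ _, fun κ => ?_⟩
  have h : (transl c z κ - c κ).valMinAbs = z κ := by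
    have := congrFun (rel_transl_of_mem_box c hr hz) κ
    rwa [rel_apply] at this
  rw [h]
  have hb := (mem_box.mp hz) κ
  rw [Pi.zero_apply, sub_zero] at hb
  have h2 : ((z κ).natAbs : ℤ) ≤ (r : ℤ) := by rw [Int.natCast_natAbs]; exact hb
  exact_mod_cast h2

/-- `x − c ∈ Q_r(0)` for `x ∈ ball_r(c)`. [folklore] [cite: Balaban1987RG1, (0.1) p.251] -/
theorem rel_mem_box (c : Site P j) {r : ℕ} {x : Site P j} (hx : ∀ κ, ((x κ - c κ).valMinAbs).natAbs ≤ r) :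
    rel c x ∈ box (0 : Zd P.d) (r : ℤ) := by
  rw [mem_box]
  intro κ
  rw [Pi.zero_apply, sub_zero, rel_apply, Int.abs_eq_natAbs]
  exact_mod_cast hx κ

/-- ★ **THE WINDOW BIJECTION**: `c + Q_r(0) = ball_r(c)` (onto; `2r + 1 ≤ N`). [folklore] [cite: Balaban1987RG1, (0.1) p.251] -/
theorem image_transl_box (c : Site P j) {r : ℕ} (hr : 2 * r + 1 ≤ P.sitesPerDir j) :
    (box (0 : Zd P.d) (r : ℤ)).image (transl c) = univ.filter (fun x : Site P j => ∀ κ, ((x κ - c κ).valMinAbs).natAbs ≤ r) := by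
  classical
  ext x
  constructor
  · intro hx
    obtain ⟨z, hz, rfl⟩ := mem_image.mp hx
    exact transl_mem_ball c hr hz
  · intro hx
    have hx' := (mem_filter.mp hx).2
    exact mem_image.mpr ⟨rel c x, rel_mem_box c hx', transl_rel c x⟩

/-- `z ↦ c + z` is injective on the window box. [folklore] [cite: Balaban1987RG1, (0.1) p.251] -/
theorem injOn_transl_box (c : Site P j) {r : ℕ} (hr : 2 * r + 1 ≤ P.sitesPerDir j) :
    Set.InjOn (transl c) ↑(box (0 : Zd P.d) (r : ℤ)) := by
  intro z hz z' hz' h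
  have h1 := rel_transl_of_mem_box c hr (mem_coe.mp hz)
  have h2 := rel_transl_of_mem_box c hr (mem_coe.mp hz')
  rw [← h1, ← h2, h]

/-- ★ **SUMS OVER A BALL ARE SUMS OVER THE WINDOW BOX**: `Σ_{x ∈ ball_r(c)} f x = Σ_{z ∈ Q_r(0)} f (c + z)`. [folklore] [cite: Balaban1987RG1, (0.1) p.251] -/
theorem sum_ball_eq_sum_box {M : Type*} [AddCommMonoid M] (c : Site P j) {r : ℕ} (hr : 2 * r + 1 ≤ P.sitesPerDir j) (f : Site P j → M) :
    ∑ x ∈ univ.filter (fun x : Site P j => ∀ κ, ((x κ - c κ).valMinAbs).natAbs ≤ r), f x = ∑ z ∈ box (0 : Zd P.d) (r : ℤ), f (transl c z) := by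
  classical
  rw [← image_transl_box c hr, sum_image (injOn_transl_box c hr)]

/-! ## §2 px18's localised-mass row on the torus, one centre (`d = 3`) -/

/-- ★★ **THE d = 3 LOCALISED-MASS ROW ON A TORUS BALL**: for a centre `c ∈ T^{(j)}`, radii `ρ ≤ R` with `2R + 1 ≤ sitesPerDir j` (no wrap) and every `t > 0`,
`Σ_{ball_ρ(c)} v² ≤ (1+t)·((2ρ+1)³∕(2R+1)³)·Σ_{ball_R(c)} v² + (1+t⁻¹)·13068·(ρ+1)²·Σ_{x ∈ ball_R(c)} Σ_μ (v(x + e_μ) − v x)²` — px18's ✓`sum_sq_le_localisedMass` read through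
the window bijection (`#Q_r = (2r+1)³`). [folklore] [cite: Giaquinta1984, Ch. III §1 pp.65–72; Balaban1984PropagatorsII, (1.9) p.226] -/
theorem sum_sq_ball_le_localisedMass (hd : P.d = 3) (c : Site P j) (v : Site P j → ℝ) {ρ R : ℕ} (hρR : ρ ≤ R)
    (hR : 2 * R + 1 ≤ P.sitesPerDir j) {t : ℝ} (ht : 0 < t) :
    ∑ x ∈ univ.filter (fun x : Site P j => ∀ κ, ((x κ - c κ).valMinAbs).natAbs ≤ ρ), v x ^ 2 ≤
      (1 + t) * ((2 * (ρ : ℝ) + 1) ^ 3 / (2 * (R : ℝ) + 1) ^ 3) *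
          ∑ x ∈ univ.filter (fun x : Site P j => ∀ κ, ((x κ - c κ).valMinAbs).natAbs ≤ R), v x ^ 2 +
        (1 + t⁻¹) * 13068 * ((ρ : ℝ) + 1) ^ 2 *
          ∑ x ∈ univ.filter (fun x : Site P j => ∀ κ, ((x κ - c κ).valMinAbs).natAbs ≤ R), ∑ μ : Fin P.d, (v (x.shift μ) - v x) ^ 2 := by
  have hρ : 2 * ρ + 1 ≤ P.sitesPerDir j := by omega
  have h := sum_sq_le_localisedMass hd (fun z => v (transl c z)) (0 : Zd P.d) (ρ := (ρ : ℤ)) (R := (R : ℤ))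
    (by positivity) (by exact_mod_cast hρR) ht
  rw [sum_ball_eq_sum_box c hρ, sum_ball_eq_sum_box c hR, sum_ball_eq_sum_box c hR]
  have e1 : (((2 * (ρ : ℤ) + 1 : ℤ) : ℝ)) ^ P.d = (2 * (ρ : ℝ) + 1) ^ 3 := by rw [hd]; push_cast; ring
  have e2 : (((2 * (R : ℤ) + 1 : ℤ) : ℝ)) ^ P.d = (2 * (R : ℝ) + 1) ^ 3 := by rw [hd]; push_cast; ring
  rw [card_box _ (by positivity : (0 : ℤ) ≤ (ρ : ℤ)), card_box _ (by positivity : (0 : ℤ) ≤ (R : ℤ)), e1, e2, gradSq_def] at h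
  have htr : ∀ (z : Zd P.d) (μ : Fin P.d), transl c (z + unitVec μ) = (transl c z).shift μ := fun z μ => transl_add_e c z μ
  simp only [fdiff_apply, htr] at h
  push_cast at h
  rw [one_div] at h
  exact h

/-! ## §3 Summed over a family of centres with pairwise disjoint big balls (`d = 3`) -/

/-- ★★ **THE ROW SUMMED OVER DISJOINT BIG BALLS**: for centres `c i` whose `R`-balls are pairwise disjoint the right-hand sides are the GLOBAL torus sums:
`Σ_i Σ_{ball_ρ(c i)} v² ≤ (1+t)·((2ρ+1)³∕(2R+1)³)·Σ_x v x² + (1+t⁻¹)·13068·(ρ+1)²·Σ_x Σ_μ (v(x + e_μ) − v x)²`. [folklore] [cite: Giaquinta1984, Ch. III §1 pp.65–72] -/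
theorem sum_sum_sq_ball_le_of_disjoint (hd : P.d = 3) {ι : Type*} [Fintype ι] (c : ι → Site P j) (v : Site P j → ℝ)
    {ρ R : ℕ} (hρR : ρ ≤ R) (hR : 2 * R + 1 ≤ P.sitesPerDir j)
    (hdisj : ∀ i i', i ≠ i' → Disjoint (univ.filter (fun x : Site P j => ∀ κ, ((x κ - c i κ).valMinAbs).natAbs ≤ R))
      (univ.filter (fun x : Site P j => ∀ κ, ((x κ - c i' κ).valMinAbs).natAbs ≤ R)))
    {t : ℝ} (ht : 0 < t) :
    ∑ i, ∑ x ∈ univ.filter (fun x : Site P j => ∀ κ, ((x κ - c i κ).valMinAbs).natAbs ≤ ρ), v x ^ 2 ≤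
      (1 + t) * ((2 * (ρ : ℝ) + 1) ^ 3 / (2 * (R : ℝ) + 1) ^ 3) * ∑ x, v x ^ 2 +
        (1 + t⁻¹) * 13068 * ((ρ : ℝ) + 1) ^ 2 * ∑ x, ∑ μ : Fin P.d, (v (x.shift μ) - v x) ^ 2 := by
  classical
  set A : ℝ := (1 + t) * ((2 * (ρ : ℝ) + 1) ^ 3 / (2 * (R : ℝ) + 1) ^ 3) with hA
  set B : ℝ := (1 + t⁻¹) * 13068 * ((ρ : ℝ) + 1) ^ 2 with hB
  have hA0 : 0 ≤ A := by positivity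
  have hB0 : 0 ≤ B := by positivity
  have key : ∀ g : Site P j → ℝ, (∀ x, 0 ≤ g x) →
      ∑ i, ∑ x ∈ univ.filter (fun x : Site P j => ∀ κ, ((x κ - c i κ).valMinAbs).natAbs ≤ R), g x ≤ ∑ x, g x := by
    intro g hg
    have hpd : (↑(univ : Finset ι) : Set ι).PairwiseDisjoint
        (fun i => univ.filter (fun x : Site P j => ∀ κ, ((x κ - c i κ).valMinAbs).natAbs ≤ R)) :=
      fun i _ i' _ hne => hdisj i i' hne
    rw [← sum_biUnion hpd]
    exact sum_le_sum_of_subset_of_nonneg (subset_univ _) fun x _ _ => hg x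
  calc ∑ i, ∑ x ∈ univ.filter (fun x : Site P j => ∀ κ, ((x κ - c i κ).valMinAbs).natAbs ≤ ρ), v x ^ 2
      ≤ ∑ i, (A * ∑ x ∈ univ.filter (fun x : Site P j => ∀ κ, ((x κ - c i κ).valMinAbs).natAbs ≤ R), v x ^ 2 +
          B * ∑ x ∈ univ.filter (fun x : Site P j => ∀ κ, ((x κ - c i κ).valMinAbs).natAbs ≤ R), ∑ μ : Fin P.d, (v (x.shift μ) - v x) ^ 2) :=
        sum_le_sum fun i _ => sum_sq_ball_le_localisedMass hd (c i) v hρR hR ht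
    _ = A * ∑ i, ∑ x ∈ univ.filter (fun x : Site P j => ∀ κ, ((x κ - c i κ).valMinAbs).natAbs ≤ R), v x ^ 2 +
          B * ∑ i, ∑ x ∈ univ.filter (fun x : Site P j => ∀ κ, ((x κ - c i κ).valMinAbs).natAbs ≤ R), ∑ μ : Fin P.d, (v (x.shift μ) - v x) ^ 2 := by
        rw [sum_add_distrib, ← mul_sum, ← mul_sum]
    _ ≤ A * ∑ x, v x ^ 2 + B * ∑ x, ∑ μ : Fin P.d, (v (x.shift μ) - v x) ^ 2 :=
        add_le_add (mul_le_mul_of_nonneg_left (key _ fun x => sq_nonneg _) hA0)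
          (mul_le_mul_of_nonneg_left (key _ fun x => sum_nonneg fun μ _ => sq_nonneg _) hB0)

/-! ## §4 The level-`l` block fibres of `T^{(0)}`: centres `embIter l y`, radius `(L^l − 1)∕2` -/

/-- `L^l ≤ |T^{(0)}|` per direction for `l ≤ m + K` (`sitesPerDir 0 = 2·L^{m+K}`). [folklore] [cite: Balaban1987RG1, (0.1) p.251] -/
theorem pow_le_sitesPerDir_zero {l : ℕ} (hl : l ≤ P.m + P.K) : P.L ^ l ≤ P.sitesPerDir 0 := by
  unfold Params.sitesPerDir
  have h1 : P.L ^ l ≤ P.L ^ (P.m + P.K - 0) := Nat.pow_le_pow_right P.L_pos (by omega)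
  omega

/-- ★ **THE BIG BALL AROUND A BLOCK CENTRE IS THE BLOCK FIBRE**: `{x : ∀ κ, |(x κ − (embIter l y) κ).valMinAbs| ≤ (L^l−1)∕2} = B^l(y)` (lit ✓`iterBlock`;
labels `(embIter l y)_κ = y_κ·L^l + (L^l−1)∕2`, ✓`val_embIter`; no wrap for `l ≤ m + K`). [cite: Balaban1984PropagatorsI, (1.6) p.18, (1.18) p.20; Balaban1987RG1, (0.1) p.251] -/
theorem ball_embIter_eq_iterBlock {l : ℕ} (hl : l ≤ P.m + P.K) (y : Site P l) :
    univ.filter (fun x : Site P 0 => ∀ κ, ((x κ - (embIter l y) κ).valMinAbs).natAbs ≤ (P.L ^ l - 1) / 2) = iterBlock l y := by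
  classical
  have hodd : 2 * ((P.L ^ l - 1) / 2) + 1 = P.L ^ l := by
    obtain ⟨k, hk⟩ := (Odd.pow P.hL.1 : Odd (P.L ^ l)); omega
  have hNl : P.sitesPerDir l * P.L ^ l = P.sitesPerDir 0 := by
    unfold Params.sitesPerDir; rw [Nat.sub_zero, mul_assoc, ← pow_add, Nat.sub_add_cancel hl]
  set R : ℕ := (P.L ^ l - 1) / 2 with hRdef
  ext x
  rw [mem_filter, mem_iterBlock_iff hl]
  simp only [mem_univ, true_and]
  constructor
  · intro hx κ
    -- `x κ = c κ + w`, `|w| ≤ R`, `val (c κ) = y_κ L^l + R`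
    set w : ℤ := (x κ - (embIter l y) κ).valMinAbs with hw
    have hwR : ((w.natAbs : ℕ) : ℤ) ≤ (R : ℤ) := by exact_mod_cast hx κ
    rw [Int.natCast_natAbs] at hwR
    obtain ⟨hw1, hw2⟩ := abs_le.mp hwR
    have hy : (y κ).val < P.sitesPerDir l := ZMod.val_lt (y κ)
    have hc : ((embIter l y) κ).val = (y κ).val * P.L ^ l + R := val_embIter hl y κ
    obtain ⟨s, hs⟩ : ∃ s : ℕ, (s : ℤ) = (R : ℤ) + w := ⟨((R : ℤ) + w).toNat, Int.toNat_of_nonneg (by omega)⟩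
    have hodd' : ((P.L ^ l : ℕ) : ℤ) = 2 * (R : ℤ) + 1 := by exact_mod_cast hodd.symm
    have hsL : s < P.L ^ l := by
      have : (s : ℤ) < ((P.L ^ l : ℕ) : ℤ) := by rw [hodd', hs]; omega
      exact_mod_cast this
    have hxe : x κ = (((y κ).val * P.L ^ l + s : ℕ) : ZMod (P.sitesPerDir 0)) := by
      have e1 : x κ = (embIter l y) κ + (w : ZMod (P.sitesPerDir 0)) := by
        rw [hw, ZMod.coe_valMinAbs]; ring
      have hw' : (w : ZMod (P.sitesPerDir 0)) = (s : ZMod (P.sitesPerDir 0)) - (R : ZMod (P.sitesPerDir 0)) := by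
        have : w = (s : ℤ) - R := by omega
        rw [this]; push_cast; ring
      rw [e1, ← ZMod.natCast_zmod_val ((embIter l y) κ), hc, hw']
      push_cast; ring
    have hlt : (y κ).val * P.L ^ l + s < P.sitesPerDir 0 := by
      calc (y κ).val * P.L ^ l + s < (y κ).val * P.L ^ l + P.L ^ l := by omega
        _ = ((y κ).val + 1) * P.L ^ l := by ring
        _ ≤ P.sitesPerDir l * P.L ^ l := Nat.mul_le_mul_right _ hy
        _ = P.sitesPerDir 0 := hNl
    rw [hxe, ZMod.val_natCast, Nat.mod_eq_of_lt hlt, Nat.add_comm, Nat.add_mul_div_right _ _ (pow_pos P.L_pos l),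
      Nat.div_eq_of_lt hsL, zero_add]
  · intro hx κ
    have hc : ((embIter l y) κ).val = (y κ).val * P.L ^ l + R := val_embIter hl y κ
    have hdiv := hx κ
    have hxv : (x κ).val < P.sitesPerDir 0 := ZMod.val_lt (x κ)
    -- `val (x κ) = y_κ L^l + u` with `u < L^l`
    obtain ⟨u, hu, hxu⟩ : ∃ u : ℕ, u < P.L ^ l ∧ (x κ).val = (y κ).val * P.L ^ l + u :=
      ⟨(x κ).val % P.L ^ l, Nat.mod_lt _ (pow_pos P.L_pos l), by rw [← hdiv, Nat.div_add_mod']⟩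
    have e1 : x κ - (embIter l y) κ = (((u : ℤ) - (R : ℤ) : ℤ) : ZMod (P.sitesPerDir 0)) := by
      rw [← ZMod.natCast_zmod_val (x κ), ← ZMod.natCast_zmod_val ((embIter l y) κ), hxu, hc]
      push_cast; ring
    have hwin : ((u : ℤ) - R) * 2 ∈ Set.Ioc (-(P.sitesPerDir 0 : ℤ)) (P.sitesPerDir 0) := by
      have hLN : (P.L ^ l : ℤ) ≤ (P.sitesPerDir 0 : ℤ) := by exact_mod_cast pow_le_sitesPerDir_zero hl
      have hodd' : (2 * R + 1 : ℤ) = (P.L ^ l : ℕ) := by exact_mod_cast hodd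
      push_cast at hodd'
      have hu' : (u : ℤ) < (P.L : ℤ) ^ l := by exact_mod_cast hu
      constructor <;> linarith
    have hv : (x κ - (embIter l y) κ).valMinAbs = (u : ℤ) - R := (ZMod.valMinAbs_spec _ _).mpr ⟨e1, hwin⟩
    rw [hv]
    have : |(u : ℤ) - R| ≤ R := by
      rw [abs_le]
      have hodd' : (2 * R + 1 : ℤ) = ((P.L ^ l : ℕ) : ℤ) := by exact_mod_cast hodd
      have hu' : (u : ℤ) < ((P.L ^ l : ℕ) : ℤ) := by exact_mod_cast hu
      constructor <;> linarith
    have h2 : (((u : ℤ) - R).natAbs : ℤ) ≤ R := by rw [Int.natCast_natAbs]; exact this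
    exact_mod_cast h2

/-- Distinct level-`l` sites have disjoint big balls (they are the disjoint block fibres, lit ✓`pairwiseDisjoint_iterBlock`). [cite: Balaban1984PropagatorsI, (1.18) p.20] -/
theorem disjoint_ball_embIter {l : ℕ} (hl : l ≤ P.m + P.K) {y y' : Site P l} (h : y ≠ y') :
    Disjoint (univ.filter (fun x : Site P 0 => ∀ κ, ((x κ - (embIter l y) κ).valMinAbs).natAbs ≤ (P.L ^ l - 1) / 2))
      (univ.filter (fun x : Site P 0 => ∀ κ, ((x κ - (embIter l y') κ).valMinAbs).natAbs ≤ (P.L ^ l - 1) / 2)) := by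
  rw [ball_embIter_eq_iterBlock hl y, ball_embIter_eq_iterBlock hl y']
  exact pairwiseDisjoint_iterBlock l Set.univ (Set.mem_univ y) (Set.mem_univ y') h

/-- ★★★ **THE N4 ROW — LEVEL-0 LOCALISED MASS ON T³ BLOCK FIBRES** (N-line namer px21 g7's cut, 2026-08-29): for `P.d = 3`, `l ≤ m + K`, `v : T^{(0)} → ℝ`,
`2ρ + 1 ≤ L^l` and every `t > 0`,
`Σ_{y ∈ T^{(l)}} Σ_{x : ∀ κ, |(x κ − (embIter l y) κ).valMinAbs| ≤ ρ} (v x)² ≤ (1+t)·((2ρ+1)³∕(L^l)³)·Σ_x (v x)² + (1+t⁻¹)·13068·(ρ+1)²·Σ_x Σ_ν (v(x + e_ν) − v x)²` —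
the mass of `v` in the `ρ`-balls around the block centres is the VOLUME FRACTION `(2ρ+1)³∕L^{3l}` of the total mass plus `13068·(ρ+1)²` (the SMALL radius squared; px18's
absolute constant) times the total gradient energy; no `l`-, `K`-, member-dependence. [folklore] [cite: Giaquinta1984, Ch. III §1 pp.65–72; Balaban1984PropagatorsII, (1.9) p.226; Balaban1984PropagatorsI, (1.18) p.20] -/
theorem sum_sq_le_localisedMass_T3 (hd : P.d = 3) {l : ℕ} (hl : l ≤ P.m + P.K) (v : Site P 0 → ℝ) {ρ : ℕ} (hρ : 2 * ρ + 1 ≤ P.L ^ l)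
    {t : ℝ} (ht : 0 < t) :
    ∑ y : Site P l, ∑ x ∈ univ.filter (fun x : Site P 0 => ∀ κ, ((x κ - (embIter l y) κ).valMinAbs).natAbs ≤ ρ), v x ^ 2 ≤
      (1 + t) * ((2 * (ρ : ℝ) + 1) ^ 3 / ((P.L : ℝ) ^ l) ^ 3) * ∑ x, v x ^ 2 +
        (1 + t⁻¹) * 13068 * ((ρ : ℝ) + 1) ^ 2 * ∑ x : Site P 0, ∑ ν : Fin P.d, (v (x.shift ν) - v x) ^ 2 := by
  have hodd : 2 * ((P.L ^ l - 1) / 2) + 1 = P.L ^ l := by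
    obtain ⟨k, hk⟩ := (Odd.pow P.hL.1 : Odd (P.L ^ l)); omega
  have hR : 2 * ((P.L ^ l - 1) / 2) + 1 ≤ P.sitesPerDir 0 := by rw [hodd]; exact pow_le_sitesPerDir_zero hl
  have hρR : ρ ≤ (P.L ^ l - 1) / 2 := by omega
  have h := sum_sum_sq_ball_le_of_disjoint hd (fun y : Site P l => embIter l y) v hρR hR
    (fun y y' hne => disjoint_ball_embIter hl hne) ht
  have hcast : (2 * (((P.L ^ l - 1) / 2 : ℕ) : ℝ) + 1) = (P.L : ℝ) ^ l := by
    have : ((2 * ((P.L ^ l - 1) / 2) + 1 : ℕ) : ℝ) = ((P.L ^ l : ℕ) : ℝ) := by rw [hodd]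
    push_cast at this
    exact this
  rw [hcast] at h
  exact h

/-! ## §5 The `‖·‖²` twins for seminormed-group-valued site and bond fields (reverse triangle inequality; NO inner product on `V`) -/

section Vector

variable {V : Type*} [SeminormedAddCommGroup V]

/-- `(‖a‖ − ‖b‖)² ≤ ‖a − b‖²` (reverse triangle inequality, squared). [folklore] -/
theorem sq_norm_sub_norm_le (a b : V) : (‖a‖ - ‖b‖) ^ 2 ≤ ‖a - b‖ ^ 2 := by
  have h := abs_norm_sub_norm_le a b
  have h0 : 0 ≤ |‖a‖ - ‖b‖| := abs_nonneg _
  calc (‖a‖ - ‖b‖) ^ 2 = |‖a‖ - ‖b‖| ^ 2 := (sq_abs _).symm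
    _ ≤ ‖a - b‖ ^ 2 := pow_le_pow_left₀ h0 h 2

/-- ★★ **THE N4 ROW FOR VECTOR-VALUED SITE FIELDS**: `Y : T^{(0)} → V`, `V` any seminormed group (e.g. `Matrix (Fin 2) (Fin 2) ℂ` with the `L²`-operator norm):
`Σ_y Σ_{ball_ρ(embIter l y)} ‖Y x‖² ≤ (1+t)·((2ρ+1)³∕(L^l)³)·Σ_x ‖Y x‖² + (1+t⁻¹)·13068·(ρ+1)²·Σ_x Σ_ν ‖Y(x + e_ν) − Y x‖²` (the scalar row at `v := ‖Y ·‖` and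
`(‖a‖ − ‖b‖)² ≤ ‖a − b‖²`). [folklore] [cite: Giaquinta1984, Ch. III §1 pp.65–72; Balaban1984PropagatorsII, (1.9) p.226] -/
theorem sum_normSq_le_localisedMass_T3 (hd : P.d = 3) {l : ℕ} (hl : l ≤ P.m + P.K) (Y : Site P 0 → V) {ρ : ℕ} (hρ : 2 * ρ + 1 ≤ P.L ^ l)
    {t : ℝ} (ht : 0 < t) :
    ∑ y : Site P l, ∑ x ∈ univ.filter (fun x : Site P 0 => ∀ κ, ((x κ - (embIter l y) κ).valMinAbs).natAbs ≤ ρ), ‖Y x‖ ^ 2 ≤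
      (1 + t) * ((2 * (ρ : ℝ) + 1) ^ 3 / ((P.L : ℝ) ^ l) ^ 3) * ∑ x, ‖Y x‖ ^ 2 +
        (1 + t⁻¹) * 13068 * ((ρ : ℝ) + 1) ^ 2 * ∑ x : Site P 0, ∑ ν : Fin P.d, ‖Y (x.shift ν) - Y x‖ ^ 2 := by
  have h := sum_sq_le_localisedMass_T3 hd hl (fun x => ‖Y x‖) hρ ht
  have hB : 0 ≤ (1 + t⁻¹) * 13068 * ((ρ : ℝ) + 1) ^ 2 := by positivity
  have hG : ∑ x : Site P 0, ∑ ν : Fin P.d, (‖Y (x.shift ν)‖ - ‖Y x‖) ^ 2 ≤ ∑ x : Site P 0, ∑ ν : Fin P.d, ‖Y (x.shift ν) - Y x‖ ^ 2 :=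
    sum_le_sum fun x _ => sum_le_sum fun ν _ => sq_norm_sub_norm_le _ _
  exact h.trans (by nlinarith [mul_le_mul_of_nonneg_left hG hB])

/-- ★★ **THE N4 ROW FOR BOND FIELDS IN THE NORM-GAP CURRENCY** (balls read on the initial point `b.src`; the gradient term is the NORM GAP
`(‖Y(b + e_ν)‖ − ‖Y b‖)²` — the letter px13 g6's N4b `…PertVarNormGradLevelZeroT3` bounds by the COVARIANT gradient, since `‖W·Y·W*‖ = ‖Y‖`): for `Y : PBond P 0 → V`,
`Σ_y Σ_{b : b.src ∈ ball_ρ(embIter l y)} ‖Y b‖² ≤ (1+t)·((2ρ+1)³∕(L^l)³)·Σ_b ‖Y b‖² + (1+t⁻¹)·13068·(ρ+1)²·Σ_b Σ_ν (‖Y ⟨b.src + e_ν, b.dir⟩‖ − ‖Y b‖)²` (the scalar row per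
direction `μ` at `v := ‖Y ⟨·, μ⟩‖`, summed over `μ`; an exact rearrangement, lit ✓`B10StarCount.sum_pbond`). [folklore] [cite: Giaquinta1984, Ch. III §1 pp.65–72; Balaban1984PropagatorsII, (1.9) p.226; Balaban1985Averaging, (5) p.18] -/
theorem sum_normSq_bond_le_localisedMass_normGap_T3 (hd : P.d = 3) {l : ℕ} (hl : l ≤ P.m + P.K) (Y : PBond P 0 → V) {ρ : ℕ} (hρ : 2 * ρ + 1 ≤ P.L ^ l)
    {t : ℝ} (ht : 0 < t) :
    ∑ y : Site P l, ∑ b ∈ univ.filter (fun b : PBond P 0 => ∀ κ, ((b.src κ - (embIter l y) κ).valMinAbs).natAbs ≤ ρ), ‖Y b‖ ^ 2 ≤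
      (1 + t) * ((2 * (ρ : ℝ) + 1) ^ 3 / ((P.L : ℝ) ^ l) ^ 3) * ∑ b, ‖Y b‖ ^ 2 +
        (1 + t⁻¹) * 13068 * ((ρ : ℝ) + 1) ^ 2 * ∑ b : PBond P 0, ∑ ν : Fin P.d, (‖Y ⟨b.src.shift ν, b.dir⟩‖ - ‖Y b‖) ^ 2 := by
  classical
  set A : ℝ := (1 + t) * ((2 * (ρ : ℝ) + 1) ^ 3 / ((P.L : ℝ) ^ l) ^ 3) with hA
  set B : ℝ := (1 + t⁻¹) * 13068 * ((ρ : ℝ) + 1) ^ 2 with hB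
  -- per direction `μ`, the scalar row for `x ↦ ‖Y ⟨x, μ⟩‖`
  have hμ : ∀ μ : Fin P.d,
      ∑ y : Site P l, ∑ x ∈ univ.filter (fun x : Site P 0 => ∀ κ, ((x κ - (embIter l y) κ).valMinAbs).natAbs ≤ ρ), ‖Y ⟨x, μ⟩‖ ^ 2 ≤
        A * ∑ x, ‖Y ⟨x, μ⟩‖ ^ 2 + B * ∑ x : Site P 0, ∑ ν : Fin P.d, (‖Y ⟨x.shift ν, μ⟩‖ - ‖Y ⟨x, μ⟩‖) ^ 2 :=
    fun μ => sum_sq_le_localisedMass_T3 hd hl (fun x => ‖Y ⟨x, μ⟩‖) hρ ht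
  -- bonds issuing from a set of sites = those sites × the directions (lit ✓`B10StarCount.sum_pbond`, filtered)
  have hsrc : ∀ (p : Site P 0 → Prop) [DecidablePred p] (F : PBond P 0 → ℝ),
      ∑ b ∈ univ.filter (fun b : PBond P 0 => p b.src), F b = ∑ x ∈ univ.filter p, ∑ μ : Fin P.d, F ⟨x, μ⟩ := by
    intro p _ F
    rw [sum_filter, sum_filter, B10StarCount.sum_pbond]
    refine sum_congr rfl fun x _ => ?_
    by_cases hx : p x
    · simp only [hx, if_true]
    · simp only [hx, if_false, sum_const_zero]
  -- rewrite the bond sums as direction × site sums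
  have eL : ∑ y : Site P l, ∑ b ∈ univ.filter (fun b : PBond P 0 => ∀ κ, ((b.src κ - (embIter l y) κ).valMinAbs).natAbs ≤ ρ), ‖Y b‖ ^ 2 =
      ∑ μ : Fin P.d, ∑ y : Site P l, ∑ x ∈ univ.filter (fun x : Site P 0 => ∀ κ, ((x κ - (embIter l y) κ).valMinAbs).natAbs ≤ ρ), ‖Y ⟨x, μ⟩‖ ^ 2 := by
    rw [sum_comm]
    refine sum_congr rfl fun y _ => ?_
    rw [hsrc (fun x : Site P 0 => ∀ κ, ((x κ - (embIter l y) κ).valMinAbs).natAbs ≤ ρ) (fun b => ‖Y b‖ ^ 2), sum_comm]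
  have eM : ∑ b : PBond P 0, ‖Y b‖ ^ 2 = ∑ μ : Fin P.d, ∑ x : Site P 0, ‖Y ⟨x, μ⟩‖ ^ 2 := by
    rw [B10StarCount.sum_pbond, sum_comm]
  have eG : ∑ b : PBond P 0, ∑ ν : Fin P.d, (‖Y ⟨b.src.shift ν, b.dir⟩‖ - ‖Y b‖) ^ 2 =
      ∑ μ : Fin P.d, ∑ x : Site P 0, ∑ ν : Fin P.d, (‖Y ⟨x.shift ν, μ⟩‖ - ‖Y ⟨x, μ⟩‖) ^ 2 := by
    rw [B10StarCount.sum_pbond, sum_comm]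
  rw [eL, eM, eG, mul_sum, mul_sum, ← sum_add_distrib]
  exact sum_le_sum fun μ _ => hμ μ

/-- ★★ **THE N4 ROW FOR VECTOR-VALUED BOND FIELDS, PLAIN-DIFFERENCE GRADIENT** (corollary: `(‖a‖ − ‖b‖)² ≤ ‖a − b‖²`):
`Σ_y Σ_{b : b.src ∈ ball_ρ(embIter l y)} ‖Y b‖² ≤ (1+t)·((2ρ+1)³∕(L^l)³)·Σ_b ‖Y b‖² + (1+t⁻¹)·13068·(ρ+1)²·Σ_b Σ_ν ‖Y ⟨b.src + e_ν, b.dir⟩ − Y b‖²`.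
[folklore] [cite: Giaquinta1984, Ch. III §1 pp.65–72; Balaban1984PropagatorsII, (1.9) p.226; Balaban1985Averaging, (5) p.18] -/
theorem sum_normSq_bond_le_localisedMass_T3 (hd : P.d = 3) {l : ℕ} (hl : l ≤ P.m + P.K) (Y : PBond P 0 → V) {ρ : ℕ} (hρ : 2 * ρ + 1 ≤ P.L ^ l)
    {t : ℝ} (ht : 0 < t) :
    ∑ y : Site P l, ∑ b ∈ univ.filter (fun b : PBond P 0 => ∀ κ, ((b.src κ - (embIter l y) κ).valMinAbs).natAbs ≤ ρ), ‖Y b‖ ^ 2 ≤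
      (1 + t) * ((2 * (ρ : ℝ) + 1) ^ 3 / ((P.L : ℝ) ^ l) ^ 3) * ∑ b, ‖Y b‖ ^ 2 +
        (1 + t⁻¹) * 13068 * ((ρ : ℝ) + 1) ^ 2 * ∑ b : PBond P 0, ∑ ν : Fin P.d, ‖Y ⟨b.src.shift ν, b.dir⟩ - Y b‖ ^ 2 := by
  have h := sum_normSq_bond_le_localisedMass_normGap_T3 hd hl Y hρ ht
  have hB : 0 ≤ (1 + t⁻¹) * 13068 * ((ρ : ℝ) + 1) ^ 2 := by positivity
  have hG : ∑ b : PBond P 0, ∑ ν : Fin P.d, (‖Y ⟨b.src.shift ν, b.dir⟩‖ - ‖Y b‖) ^ 2 ≤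
      ∑ b : PBond P 0, ∑ ν : Fin P.d, ‖Y ⟨b.src.shift ν, b.dir⟩ - Y b‖ ^ 2 :=
    sum_le_sum fun b _ => sum_le_sum fun ν _ => sq_norm_sub_norm_le _ _
  exact h.trans (by nlinarith [mul_le_mul_of_nonneg_left hG hB])

end Vector

end Summit.QuantumFields.YangMills.Theorems.Prop7LatticeLocalisedMassT3

end
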